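import Summits.HodgeConjecture.CorCM.DictionaryA3
import Summits.HodgeConjecture.CorCM.Model.CMDominationGuard
import HarnessLib

/-!
# COR-CM assembly (b11, row B03): guarded CM domination from Riemann's theorem — the `dom` input of the E term

Cell `pub-hodgecm2` (COR-CM), seat `b11`; row B03 of `HOME/BINDER-OWNERS.md` as RE-TYPED by the lead's ruling
B03-RETYPE (2026-08-20): `∀ h₁ h₃, DeligneMilne1982_Thm_6_20_full → CMDominatedByCodesPos (ballQuotientUniformisedDatum_of h₁) h₃`
— the first argument `dom` of the E term's A3 composite `hc_cm_of_PerLFace_of_modelChain (dom) (chain) : HC_CM_of_PerLFace`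
(`CorCM/DictionaryA3.lean`, v2 GUARDED form; the unguarded v1 binder was false, `Model.not_hDom`).  KERNEL ONLY (theorems;
no definition, no named fact).

* `dom_of_riemann` — **B03 DISCHARGED** from stage 1's cited record B02 `hR : DeligneMilne1982_Thm_6_20_full` alone:
  `CMDominatedByCodesPos hU h₃` is by `rfl` the conclusion of `Model.hDomPos_of_riemann hR hU h₃`
  (`CorCM/Model/CMDominationGuard.lean` = tree `Milne1999.hDomPos_of_hDecompPos (thm2_cor_of_riemann hR)` ∘
  `hDecompPos_of_hSimplePos (hSimplePos_of_riemann hR)`: Poincaré reducibility, Shimura 1998 §5.1 Props. 3–6, §6.1 Cor. of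
  Thm. 2, §7.1 Prop. 7, over Riemann's theorem, LNM 900 Thm. 6.20).
* `hc_cm_of_PerLFace_of_modelChain_of_riemann` — the E term's shape with B03 discharged: the model chain
  `∀ hHD hI h₁ h₃, U.PerLFace → U.HC_CM` ALONE gives `HC_CM_of_PerLFace` (`hc_cm_of_PerLFace_of_modelChain dom_of_riemann`).

Deliberately NOT here: the model chain itself (row P7, `CorCM/Assembly/ModelChain.lean`), any statement of `HC_CM`,
`PerLFace` or `CMDominatedByCodesPos` (imported BY NAME).
-/

noncomputable section

namespace Summit.HodgeConjecture.CorCM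

open Literature.NumberTheory.Automorphic.PicardCM
open Literature.AlgebraicGeometry.HodgeTheory

namespace Assembly

/-- **Row B03 discharged (`dom` of the E term).**  For every instance `h₁`, `h₃` of the model's realisation records,
Riemann's theorem `DeligneMilne1982_Thm_6_20_full` (binder B02) gives guarded CM domination by the model's CM codes
`CMDominatedByCodesPos (ballQuotientUniformisedDatum_of h₁) h₃` — every complex abelian variety of CM type of positive
dimension is isogenous to the interpretation of a CM-flagged code (`Model.hDomPos_of_riemann`). [folklore] -/
theorem dom_of_riemann :
    ∀ (h₁ : BallQuotientUniformised) (h₃ : CMAbelianVarietyRealised),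
      DeligneMilne1982_Thm_6_20_full → CMDominatedByCodesPos (ballQuotientUniformisedDatum_of h₁) h₃ :=
  fun h₁ h₃ hR => Model.hDomPos_of_riemann hR (ballQuotientUniformisedDatum_of h₁) h₃

/-- **The E term's shape with B03 discharged**: a proof of the package chain A0 → A1 → A2 ON THE MODEL
(`U.PerLFace → U.HC_CM` for `U := Model.picardCMUniverse hHD hI h₁ h₃`, row P7) alone gives the working target
`HC_CM_of_PerLFace` — `hc_cm_of_PerLFace_of_modelChain dom_of_riemann chain`. [folklore] -/
theorem hc_cm_of_PerLFace_of_modelChain_of_riemann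
    (chain : ∀ (hHD : exists_isReal_hodgeModel) (hI : hodgePQ_independent_of_hodgeModel)
      (h₁ : BallQuotientUniformised) (h₃ : CMAbelianVarietyRealised),
      (Model.picardCMUniverse hHD hI h₁ h₃).PerLFace → (Model.picardCMUniverse hHD hI h₁ h₃).HC_CM) :
    HC_CM_of_PerLFace :=
  hc_cm_of_PerLFace_of_modelChain dom_of_riemann chain

end Assembly

end Summit.HodgeConjecture.CorCM

end
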